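import Summits.QuantumFields.BalabanUV.Beta.D1BFx.PackedGhostWordEnd
import Summits.QuantumFields.BalabanUV.Beta.D1BFx.GluonLeg

/-!
# `BalabanUV.Beta.D1BFx.PackedRoadJ2Scaling` — road «BF-x» for binder row D1, slot (K): «(J2) FROM THE DICTIONARY BY SCALING» —
# **the owner's W-13 sufficient condition for the junction (J2) with ZERO rest, as a theorem**

PART 10 (`PackedRoadHptwScales.hptw_of_junctions`) ∕ PART 11 (`RoadEndBFxJunctionsS`) display the (A2-N) TABLE dictionary of the road as ONE
hypothesis per scale, AT THE END's LETTERS: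
`hJ2 : (2⁻¹)²·TOfLeg n (Ga n a) S_road (fun … => (2⁻¹)⁻¹ • W_road …) μ ν z = ωgl n * TOfRed n a SB TB μ ν z + RJ2 n μ ν z`
(`S_road κ u := blk (coProjBmAtK (toSite (r n)) n (SN (n−1) a (S n)) κ u) tt`, `W_road := ffW (W2NInf (n−1) a (r n) (S₂ n))`,
`SB := SbfBal n a (cE n) …`, `TB := tableRed n (Wbf …)`).  Since `TOfRed n a SB TB = TOfLeg n (Ga n a) SB TB` definitionally and the one-loop
kernel is LINEAR in the table and QUADRATIC in the stencil family, (J2) holds WITH `RJ2 = 0` as soon as the END's stencils and tables ARE the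
road's up to ONE scalar: `SB = c • S_road`, `TB = (2c²) • W_road`, `ωgl n · c² = ¼` (the owner's W-13, journal l.41636).  This file is that
implication, generic in the leg:
* §1 `hessKer_smul_jets` (`hessKer A (c•V) (c²•W) = c²·hessKer A V W`), `TOfLeg_smul_jets` (`vertexRedF` is linear: `PackedGhostWordEnd.vertexRedF_const_smul`);
* §2 **`J2_of_scaling`** — PART 10's `hJ2` at scale `n` with `RJ2 n μ ν z` read as `0`, from `hSB`∕`hTB`∕`hω`.
an2's Q-DICT-N ruling decides whether the identification holds in this zero-rest form or WITH a rest (an1 W-an1-g67-1: `S_lit = SbfBal + ΔS`);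
in the latter case (J2)'s `RJ2` is the one-loop word of the differences and needs its own unit-class row — not this file.

HONEST DEPENDENCY (cell records, verbatim): «continuum YM on T⁴ ⇐ BetaPertH ∧ nine spine estimates (0/9 proved); BetaPertH ⇐ (D1) ∧ (D4) ∧
CAP+tail; G-an2-4 gates asym, D1 and NE2/3/4.»  THIS MODULE DISCHARGES NOTHING of (K), of D1 or of the wall: [folklore] bilinearity; the
dictionary identities `hSB`∕`hTB`∕`hω` are HYPOTHESES.  No definition, no `def … : Prop`, nothing cited, 0 sorry.  0 root-level binders of row D1
discharged; (K) NOT closed; NOT D1, NOT `BetaPertH`, NOT continuum, NOT Clay.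
ABSOLUTE RULE (cell charter, verbatim): «No internally-minted statement may enter as a cited fact. Every hypothesis is either kernel-proved in this
package or a verbatim quotation of a PUBLISHED theorem with page reference. The manuscript(s) under audit are NOT citable for their own disputed
steps — they are the thing under adjudication; programme-internal (2001/route/tribunal) claims are never citable.»
Unit `b2b-balaban-beta-d1-p2` (road owner, gen 19), 2026-08-22.
-/

noncomputable section

namespace Summit.QuantumFields.BalabanUV.Beta.D1BFx.PackedRoadJ2Scaling

open scoped BigOperators
open Literature.MathematicalPhysics.QuantumFieldTheory.Balaban1983to89
open Literature.MathematicalPhysics.QuantumFieldTheory.Balaban1983to89.Beta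
open ExpKernelCalculus (Site MKer hessKer)
open KernelReflection (bubble_smul_left bubble_smul_right tadpole_smul)
open Summit.QuantumFields.BalabanUV.Beta.D1BFx.ReducedKernel (StencilR TableR TOfRed)
open Summit.QuantumFields.BalabanUV.Beta.D1BFx.ReducedKernelF (vertexRedF TOfLeg TOfRed_eq_TOfLeg)
open Summit.QuantumFields.BalabanUV.Beta.D1BFx.PackedGhostWordEnd (vertexRedF_const_smul)
open Summit.QuantumFields.BalabanUV.Beta.D1BFx.GluonLeg (Ga)

/-! ## §1 The one-loop kernel is quadratic in the stencils and linear in the tables -/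

section Generic

variable {D : ℕ} {F : Type*} [Fintype F]

/-- [folklore] **JET SCALING OF THE ONE-LOOP KERNEL**: the bubble is quadratic in the vertex family and the tadpole linear in the table family, so
`hessKer A (c•V) (c²•W) μ ν z = c²·hessKer A V W μ ν z`. -/
theorem hessKer_smul_jets (c : ℝ) (A : MKer D F) (V : Fin D → Site D → MKer D F) (W : Fin D → Site D → Fin D → Site D → MKer D F)
    (μ ν : Fin D) (z : Site D) :
    hessKer A (fun μ' y => c • V μ' y) (fun μ' y ν' y' => (c ^ 2) • W μ' y ν' y') μ ν z = c ^ 2 * hessKer A V W μ ν z := by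
  simp only [hessKer]
  rw [tadpole_smul, bubble_smul_left, bubble_smul_right]
  ring

/-- [folklore] **TABLE SCALING ALONE**: the tadpole is linear in the table, so scaling the table family by `c` shifts the kernel by
`(c − 1)·½·tadpole A (W μ 0 ν z)` — the defect a table dictionary with the WRONG normalisation leaves behind (the bubble is untouched). -/
theorem hessKer_smul_table (c : ℝ) (A : MKer D F) (V : Fin D → Site D → MKer D F) (W : Fin D → Site D → Fin D → Site D → MKer D F)
    (μ ν : Fin D) (z : Site D) :
    hessKer A V (fun μ' y ν' y' => c • W μ' y ν' y') μ ν z = hessKer A V W μ ν z + (c - 1) * ((1 / 2) * ExpKernelCalculus.tadpole A (W μ 0 ν z)) := by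
  simp only [hessKer]
  rw [tadpole_smul]
  ring

end Generic

variable {F : Type*} [Fintype F] (n : ℕ) [NeZero n]

/-- [folklore] **JET SCALING OF `TOfLeg`**: `TOfLeg n A (c•S) (c²•W) μ ν z = c²·TOfLeg n A S W μ ν z` (`vertexRedF` is linear in the stencil family). -/
theorem TOfLeg_smul_jets (c : ℝ) (A : MKer 4 F) (S : Fin 4 → Site 4 → MKer 4 F) (W : Fin 4 → Site 4 → Fin 4 → Site 4 → MKer 4 F)
    (μ ν : Fin 4) (z : Site 4) :
    TOfLeg n A (fun κ u => c • S κ u) (fun μ' y ν' y' => (c ^ 2) • W μ' y ν' y') μ ν z = c ^ 2 * TOfLeg n A S W μ ν z := by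
  have h : vertexRedF n (fun κ u => c • S κ u) = fun μ' y => c • vertexRedF n S μ' y :=
    funext fun μ' => funext fun y => vertexRedF_const_smul c S μ' y
  simp only [TOfLeg]
  rw [h]
  exact hessKer_smul_jets c A (vertexRedF n S) W μ ν z

/-! ## §2 (J2) with zero rest from the dictionary by scaling -/

/-- [folklore] **«(J2) FROM THE DICTIONARY BY SCALING» (the owner's W-13 as a theorem).**  If the END's reduced stencils and tables ARE the road's
gluon-word data up to one scalar `c` — `SB = c • S_road`, `TB = (2·c²) • W_road` — and the END's gluon weight satisfies `ωgl′ · c² = (2⁻¹)²`, then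
PART 10's junction hypothesis (J2) holds at this scale WITH ZERO REST:
`(2⁻¹)²·TOfLeg n (Ga n a) S_road ((2⁻¹)⁻¹ • W_road) μ ν z = ωgl′ · TOfRed n a SB TB μ ν z + 0`. -/
theorem J2_of_scaling (a : ℝ) (Sroad : Fin 4 → Site 4 → MKer 4 (Fin 4)) (Wroad : Fin 4 → Site 4 → Fin 4 → Site 4 → MKer 4 (Fin 4))
    (SB : StencilR) (TB : TableR) (c ωgl' : ℝ)
    (hSB : SB = fun κ u => c • Sroad κ u) (hTB : TB = fun μ' y ν' y' => (2 * c ^ 2) • Wroad μ' y ν' y') (hω : ωgl' * c ^ 2 = ((2 : ℝ)⁻¹) ^ 2)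
    (μ ν : Fin 4) (z : Site 4) :
    ((2 : ℝ)⁻¹) ^ 2 * TOfLeg n (Ga n a) Sroad (fun μ' y ν' y' => ((2 : ℝ)⁻¹)⁻¹ • Wroad μ' y ν' y') μ ν z = ωgl' * TOfRed n a SB TB μ ν z + 0 := by
  have h2 : (fun μ' y ν' y' => (2 * c ^ 2) • Wroad μ' y ν' y') = fun μ' y ν' y' => (c ^ 2) • ((fun μ'' y'' ν'' y''' => (2 : ℝ) • Wroad μ'' y'' ν'' y''') μ' y ν' y') := by
    funext μ' y ν' y'
    rw [smul_smul, mul_comm]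
  have hinv : ((2 : ℝ)⁻¹)⁻¹ = 2 := inv_inv 2
  rw [add_zero, TOfRed_eq_TOfLeg, hSB, hTB, h2, TOfLeg_smul_jets, hinv, ← hω]
  ring

/-- [folklore] The same in the END's per-scale currency: for letter families `SBf TBf : ℕ → …`, `ωgl : ℕ → ℝ`, road data `Sroad Wroad` at scale `n`
and a rest KERNEL read as `0`, the dictionary-by-scaling gives PART 10's `hJ2` line at `n` with `RJ2 n μ ν z = 0`. -/
theorem J2_of_scaling' (a : ℝ) (Sroad : Fin 4 → Site 4 → MKer 4 (Fin 4)) (Wroad : Fin 4 → Site 4 → Fin 4 → Site 4 → MKer 4 (Fin 4))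
    (SB : StencilR) (TB : TableR) (c ωgl' : ℝ) (RJ2 : Fin 4 → Fin 4 → Site 4 → ℝ) (hRJ2 : RJ2 = fun _ _ _ => 0)
    (hSB : SB = fun κ u => c • Sroad κ u) (hTB : TB = fun μ' y ν' y' => (2 * c ^ 2) • Wroad μ' y ν' y') (hω : ωgl' * c ^ 2 = ((2 : ℝ)⁻¹) ^ 2)
    (μ ν : Fin 4) (z : Site 4) :
    ((2 : ℝ)⁻¹) ^ 2 * TOfLeg n (Ga n a) Sroad (fun μ' y ν' y' => ((2 : ℝ)⁻¹)⁻¹ • Wroad μ' y ν' y') μ ν z = ωgl' * TOfRed n a SB TB μ ν z + RJ2 μ ν z := by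
  rw [hRJ2]
  exact J2_of_scaling n a Sroad Wroad SB TB c ωgl' hSB hTB hω μ ν z

end Summit.QuantumFields.BalabanUV.Beta.D1BFx.PackedRoadJ2Scaling

end
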